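import Summits.CriticalPhenomena.Ising3DConformalLimit.Theorems.GapForcesFarMerging.Negative.SoftShapes

/-!
# `GapForcesFarMerging` is not soft, II: the kernel and the generic package theorem

Part 2/4 — the explicit kernel `S₀` has every two-point property of the package, the pairing
data are permutation / translation symmetric, and EVERY admissible deformation `θ` gives a family
`F_θ` with the full soft package (`softPackage_Fθ_core`, bubble divergence taken as input; it is
proved in Part 4).

Split (Theorems files are ≤ 400 lines) of the theorem content of the standing adversary's work file
`Summits/CriticalPhenomena/Ising3DConformalLimit/Cruxes/GapForcesFarMerging/Disproof.lean`
(crux `stmt-CriticalPhenomena-4468`, route `EnergyNotSigmaSquared`), landed under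
`Theorems/GapForcesFarMerging/Negative/` so that ideators, planners and provers can import it.

## References

* M. Aizenman, Comm. Math. Phys. 86 (1982) 1–48 [AizenmanCMP1982].
* M. Aizenman, H. Duminil-Copin, Ann. Math. 194 (2021), §3 eqs. (3.7), (3.11)–(3.12)
  [AizenmanDuminilCopinAnnals2021].
* J. L. Lebowitz, Comm. Math. Phys. 35 (1974) 87–92 [Lebowitz1974].
* H. Duminil-Copin, R. Panis, arXiv:2404.05700, Thm 1.8 [DuminilCopinPanis2025LowerBounds].
-/

noncomputable section

namespace Summit.CriticalPhenomena.Ising3DConformalLimit.Theorems.GapForcesFarMerging.Negative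

open Literature.Probability.LatticeModels
open Summit.CriticalPhenomena.Ising3DConformalLimit.Theses.EnergyNotSigmaSquared

/-- `g > 0`. [folklore] -/
theorem g_pos (v : Site 3) : 0 < g v := by unfold g; positivity

/-- `g ≤ 1`. [folklore] -/
theorem g_le_one (v : Site 3) : g v ≤ 1 := by
  unfold g; exact inv_le_one_of_one_le₀ (by simp)

/-- `g(0) = 1`. [folklore] -/
theorem g_zero : g 0 = 1 := by simp [g]

/-- `g` is even. [folklore] -/
theorem g_neg (v : Site 3) : g (-v) = g v := by simp [g]

/-- `g` is radially non-increasing in the sup norm. [folklore] -/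
theorem g_anti {v w : Site 3} (h : ‖v‖ ≤ ‖w‖) : g w ≤ g v := by
  unfold g
  exact inv_anti₀ (by positivity) (by linarith)

/-- Non-zero lattice vectors have sup norm `≥ 1`. [folklore] -/
theorem one_le_norm_of_ne_zero {x : Site 3} (hx : x ≠ 0) : (1 : ℝ) ≤ ‖x‖ := by
  obtain ⟨i, hi⟩ : ∃ i, x i ≠ 0 := by
    by_contra h
    push Not at h
    exact hx (funext h)
  calc (1 : ℝ) ≤ ‖x i‖ := by
        rw [Int.norm_eq_abs]
        exact_mod_cast Int.one_le_abs hi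
    _ ≤ ‖x‖ := norm_le_pi_norm x i

/-- The sup norm on `ℤ³` is invariant under coordinate permutations. [folklore] -/
theorem norm_comp_perm (v : Site 3) (π : Equiv.Perm (Fin 3)) : ‖v ∘ ⇑π‖ = ‖v‖ := by
  simp only [Pi.norm_def]
  congr 1
  apply le_antisymm
  · exact Finset.sup_le fun i _ => Finset.le_sup (f := fun b => ‖v b‖₊) (Finset.mem_univ (π i))
  · refine Finset.sup_le fun i _ => ?_
    have : ‖v i‖₊ = ‖(v ∘ ⇑π) (π.symm i)‖₊ := by simp
    rw [this]
    exact Finset.le_sup (f := fun b => ‖(v ∘ ⇑π) b‖₊) (Finset.mem_univ _)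

/-- The sup norm on `ℤ³` is invariant under a coordinate sign flip. [folklore] -/
theorem norm_flipAt (k : Fin 3) (v : Site 3) : ‖flipAt k v‖ = ‖v‖ := by
  simp only [Pi.norm_def]
  congr 1
  refine Finset.sup_congr rfl fun i _ => ?_
  by_cases h : i = k
  · subst h; simp [flipAt]
  · simp [flipAt, h]

/-- Sign flips are additive. [folklore] -/
theorem flipAt_sub (k : Fin 3) (a b : Site 3) : flipAt k b - flipAt k a = flipAt k (b - a) := by
  funext i
  by_cases h : i = k
  · subst h; simp [flipAt, neg_add_eq_sub]
  · simp [flipAt, h]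

/-- `S₀` is symmetric. [folklore] -/
theorem S₀_symm (a b : Site 3) : S₀ a b = S₀ b a := by
  unfold S₀; rw [← g_neg, neg_sub]

/-- `S₀` is translation invariant. [folklore] -/
theorem S₀_transl (a b v : Site 3) : S₀ (a + v) (b + v) = S₀ a b := by
  simp [S₀, add_sub_add_right_eq_sub]

/-- `S₀` is invariant under coordinate permutations. [folklore] -/
theorem S₀_perm (π : Equiv.Perm (Fin 3)) (a b : Site 3) : S₀ (a ∘ ⇑π) (b ∘ ⇑π) = S₀ a b := by
  unfold S₀ g
  have : b ∘ ⇑π - a ∘ ⇑π = (b - a) ∘ ⇑π := rfl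
  rw [this, norm_comp_perm]

/-- `S₀` is invariant under coordinate reflections. [folklore] -/
theorem S₀_refl (k : Fin 3) (a b : Site 3) : S₀ (flipAt k a) (flipAt k b) = S₀ a b := by
  unfold S₀ g
  rw [flipAt_sub, norm_flipAt]

/-- `S₀(a,a) = 1`. [folklore] -/
theorem S₀_diag (a : Site 3) : S₀ a a = 1 := by simp [S₀, g_zero]

/-- `S₀ > 0`. [folklore] -/
theorem S₀_pos (a b : Site 3) : 0 < S₀ a b := g_pos _

/-- `S₀ ≥ 0`. [folklore] -/
theorem S₀_nonneg (a b : Site 3) : 0 ≤ S₀ a b := (g_pos _).le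

/-- `S₀ ≤ 1`. [folklore] -/
theorem S₀_le_one (a b : Site 3) : S₀ a b ≤ 1 := g_le_one _

/-- `S₀(0,x) = g(x)`. [folklore] -/
theorem S₀_zero_left (x : Site 3) : S₀ 0 x = g x := by simp [S₀]

/-- The `ℤ³` infrared-type upper bound for `S₀`: `S₀(0,x) ≤ ‖x‖⁻¹`. [folklore] -/
theorem S₀_upper (x : Site 3) (hx : x ≠ 0) : S₀ 0 x ≤ 1 * (‖x‖ : ℝ) ^ (-(1 : ℝ)) := by
  rw [S₀_zero_left, Real.rpow_neg_one, one_mul]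
  unfold g
  have h1 := one_le_norm_of_ne_zero hx
  exact inv_anti₀ (by linarith) (by linarith)

/-- The `ℤ³` Simon–Lieb-type lower bound for `S₀`: `‖x‖⁻²/2 ≤ S₀(0,x)`. [folklore] -/
theorem S₀_lower (x : Site 3) (hx : x ≠ 0) : (1 / 2) * (‖x‖ : ℝ) ^ (-(2 : ℝ)) ≤ S₀ 0 x := by
  rw [S₀_zero_left]
  have h1 := one_le_norm_of_ne_zero hx
  have hpow : (‖x‖ : ℝ) ^ (-(2 : ℝ)) = (‖x‖ ^ 2)⁻¹ := by
    rw [Real.rpow_neg (norm_nonneg _), Real.rpow_two]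
  rw [hpow]
  unfold g
  rw [div_mul_eq_mul_div, one_mul, div_le_iff₀ (by positivity : (0 : ℝ) < 2)]
  calc (‖x‖ ^ 2)⁻¹ ≤ ((1 + ‖x‖) / 2)⁻¹ := inv_anti₀ (by positivity) (by nlinarith)
    _ = (1 + ‖x‖)⁻¹ * 2 := by rw [inv_div]; ring

/-- `S₀` satisfies the Messager–Miracle-Solé comparison `3‖v‖ ≤ ‖w‖ ⇒ S₀(0,w) ≤ S₀(0,v)`. [folklore] -/
theorem S₀_mms (v w : Site 3) (h : 3 * ‖v‖ ≤ ‖w‖) : S₀ 0 w ≤ S₀ 0 v := by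
  rw [S₀_zero_left, S₀_zero_left]
  exact g_anti (by nlinarith [norm_nonneg v])

/-- `S₀` satisfies the GKS pair inequality `S₀(a,b)S₀(b,c) ≤ S₀(a,c)` (triangle inequality for the
sup norm). [folklore] -/
theorem S₀_gks_pair (a b c : Site 3) : S₀ a b * S₀ b c ≤ S₀ a c := by
  unfold S₀ g
  have htri : ‖c - a‖ ≤ ‖b - a‖ + ‖c - b‖ := by
    calc ‖c - a‖ = ‖(c - b) + (b - a)‖ := by rw [sub_add_sub_cancel]
      _ ≤ ‖c - b‖ + ‖b - a‖ := norm_add_le _ _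
      _ = ‖b - a‖ + ‖c - b‖ := add_comm _ _
  rw [← mul_inv]
  apply inv_anti₀ (by positivity)
  nlinarith [norm_nonneg (b - a), norm_nonneg (c - b)]

section symm
variable {S : Site 3 → Site 3 → ℝ} (hS : ∀ a b, S a b = S b a)
include hS

/-- The Wick sum is invariant under the transposition `(0 1)`. [folklore] -/
theorem wick_swap01 (y : Fin 4 → Site 3) : wick S (y ∘ ⇑(Equiv.swap (0 : Fin 4) 1)) = wick S y := by
  simp [wick, P₁, P₂, P₃, Equiv.swap_apply_of_ne_of_ne, hS (y 1) (y 0)]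
  ring

/-- The Wick sum is invariant under the transposition `(1 2)`. [folklore] -/
theorem wick_swap12 (y : Fin 4 → Site 3) : wick S (y ∘ ⇑(Equiv.swap (1 : Fin 4) 2)) = wick S y := by
  simp [wick, P₁, P₂, P₃, Equiv.swap_apply_of_ne_of_ne, hS (y 2) (y 1)]
  ring

/-- The Wick sum is invariant under the transposition `(2 3)`. [folklore] -/
theorem wick_swap23 (y : Fin 4 → Site 3) : wick S (y ∘ ⇑(Equiv.swap (2 : Fin 4) 3)) = wick S y := by
  simp [wick, P₁, P₂, P₃, Equiv.swap_apply_of_ne_of_ne, hS (y 3) (y 2)]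
  ring

/-- The smallest pairing product is invariant under `(0 1)`. [folklore] -/
theorem pmin_swap01 (y : Fin 4 → Site 3) : pmin S (y ∘ ⇑(Equiv.swap (0 : Fin 4) 1)) = pmin S y := by
  simp only [pmin, P₁, P₂, P₃, Function.comp_apply, Equiv.swap_apply_left, Equiv.swap_apply_right,
    Equiv.swap_apply_of_ne_of_ne (show (2 : Fin 4) ≠ 0 by decide) (show (2 : Fin 4) ≠ 1 by decide),
    Equiv.swap_apply_of_ne_of_ne (show (3 : Fin 4) ≠ 0 by decide) (show (3 : Fin 4) ≠ 1 by decide),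
    hS (y 1) (y 0)]
  rw [mul_comm (S (y 1) (y 2)), mul_comm (S (y 1) (y 3))]
  ac_rfl

/-- The smallest pairing product is invariant under `(1 2)`. [folklore] -/
theorem pmin_swap12 (y : Fin 4 → Site 3) : pmin S (y ∘ ⇑(Equiv.swap (1 : Fin 4) 2)) = pmin S y := by
  simp only [pmin, P₁, P₂, P₃, Function.comp_apply, Equiv.swap_apply_left, Equiv.swap_apply_right,
    Equiv.swap_apply_of_ne_of_ne (show (0 : Fin 4) ≠ 1 by decide) (show (0 : Fin 4) ≠ 2 by decide),
    Equiv.swap_apply_of_ne_of_ne (show (3 : Fin 4) ≠ 1 by decide) (show (3 : Fin 4) ≠ 2 by decide),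
    hS (y 2) (y 1)]
  ac_rfl

/-- The smallest pairing product is invariant under `(2 3)`. [folklore] -/
theorem pmin_swap23 (y : Fin 4 → Site 3) : pmin S (y ∘ ⇑(Equiv.swap (2 : Fin 4) 3)) = pmin S y := by
  simp only [pmin, P₁, P₂, P₃, Function.comp_apply, Equiv.swap_apply_left, Equiv.swap_apply_right,
    Equiv.swap_apply_of_ne_of_ne (show (0 : Fin 4) ≠ 2 by decide) (show (0 : Fin 4) ≠ 3 by decide),
    Equiv.swap_apply_of_ne_of_ne (show (1 : Fin 4) ≠ 2 by decide) (show (1 : Fin 4) ≠ 3 by decide),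
    hS (y 3) (y 2)]
  rw [mul_comm (S (y 0) (y 3)) (S (y 1) (y 2)), mul_comm (S (y 0) (y 2)) (S (y 1) (y 3))]
  ac_rfl

end symm

/-- A lower bound on all pairwise distances bounds `sep` from below. [folklore] -/
theorem le_sep {y : Fin 4 → Site 3} {m : ℝ} (h : ∀ i j : Fin 4, i ≠ j → m ≤ ‖y i - y j‖) :
    m ≤ sep y :=
  le_min (h 0 1 (by decide)) (le_min (h 0 2 (by decide)) (le_min (h 0 3 (by decide))
    (le_min (h 1 2 (by decide)) (le_min (h 1 3 (by decide)) (h 2 3 (by decide))))))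

/-- `sep` is at most each pairwise distance. [folklore] -/
theorem sep_le_norm (y : Fin 4 → Site 3) {i j : Fin 4} (h : i ≠ j) : sep y ≤ ‖y i - y j‖ := by
  have h01 : sep y ≤ ‖y 0 - y 1‖ := min_le_left _ _
  have h02 : sep y ≤ ‖y 0 - y 2‖ := (min_le_right _ _).trans (min_le_left _ _)
  have h03 : sep y ≤ ‖y 0 - y 3‖ :=
    (min_le_right _ _).trans ((min_le_right _ _).trans (min_le_left _ _))
  have h12 : sep y ≤ ‖y 1 - y 2‖ :=
    (min_le_right _ _).trans ((min_le_right _ _).trans ((min_le_right _ _).trans (min_le_left _ _)))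
  have h13 : sep y ≤ ‖y 1 - y 3‖ :=
    (min_le_right _ _).trans ((min_le_right _ _).trans ((min_le_right _ _).trans
      ((min_le_right _ _).trans (min_le_left _ _))))
  have h23 : sep y ≤ ‖y 2 - y 3‖ :=
    (min_le_right _ _).trans ((min_le_right _ _).trans ((min_le_right _ _).trans
      ((min_le_right _ _).trans (min_le_right _ _))))
  fin_cases i <;> fin_cases j <;>
    first | exact absurd rfl h | (simp only at *; first | assumption | (rw [norm_sub_rev]; assumption))

/-- `sep` is invariant under every permutation of the four points. [folklore] -/
theorem sep_comp_perm (y : Fin 4 → Site 3) (σ : Equiv.Perm (Fin 4)) : sep (y ∘ ⇑σ) = sep y := by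
  apply le_antisymm
  · refine le_sep fun i j hij => ?_
    have h := sep_le_norm (y ∘ ⇑σ) (i := σ.symm i) (j := σ.symm j) (by simpa using hij)
    simpa using h
  · refine le_sep fun i j hij => ?_
    exact sep_le_norm y (i := σ i) (j := σ j) (by simpa using hij)

/-- `sep` is translation invariant. [folklore] -/
theorem sep_transl (y : Fin 4 → Site 3) (v : Site 3) : sep (fun i => y i + v) = sep y := by
  simp [sep, add_sub_add_right_eq_sub]

/-- `sep ≥ 0`. [folklore] -/
theorem sep_nonneg (y : Fin 4 → Site 3) : 0 ≤ sep y :=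
  le_sep fun _ _ _ => norm_nonneg _

/-- `sep = 0` at a coincidence. [folklore] -/
theorem sep_coincide (a x z : Site 3) : sep ![a, a, x, z] = 0 := by
  apply le_antisymm _ (sep_nonneg _)
  have h := sep_le_norm ![a, a, x, z] (i := 0) (j := 1) (by decide)
  simpa using h

/-- The Wick sum of `S₀` is translation invariant. [folklore] -/
theorem wick_transl (y : Fin 4 → Site 3) (v : Site 3) : wick S₀ (fun i => y i + v) = wick S₀ y := by
  simp [wick, P₁, P₂, P₃, S₀_transl]

/-- The smallest pairing product of `S₀` is translation invariant. [folklore] -/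
theorem pmin_transl (y : Fin 4 → Site 3) (v : Site 3) : pmin S₀ (fun i => y i + v) = pmin S₀ y := by
  simp [pmin, P₁, P₂, P₃, S₀_transl]

/-- `Pmin ≥ 0`. [folklore] -/
theorem pmin_nonneg (y : Fin 4 → Site 3) : 0 ≤ pmin S₀ y := by
  unfold pmin P₁ P₂ P₃
  refine le_min (le_min ?_ ?_) ?_ <;> exact mul_nonneg (S₀_nonneg _ _) (S₀_nonneg _ _)

/-- `Pmin ≤ P₁`. [folklore] -/
theorem pmin_le_P₁ (y : Fin 4 → Site 3) : pmin S₀ y ≤ P₁ S₀ y :=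
  (min_le_left _ _).trans (min_le_left _ _)

/-- `Pmin ≤ P₂`. [folklore] -/
theorem pmin_le_P₂ (y : Fin 4 → Site 3) : pmin S₀ y ≤ P₂ S₀ y :=
  (min_le_left _ _).trans (min_le_right _ _)

/-- `Pmin ≤ P₃`. [folklore] -/
theorem pmin_le_P₃ (y : Fin 4 → Site 3) : pmin S₀ y ≤ P₃ S₀ y := min_le_right _ _

/-- `F_θ - Wick = -2·Pmin·θ`: the Ursell function of the deformed family. [folklore] -/
theorem Fθ_sub_wick (θ : (Fin 4 → Site 3) → ℝ) (y : Fin 4 → Site 3) :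
    Fθ θ y - (S₀ (y 0) (y 1) * S₀ (y 2) (y 3) + S₀ (y 0) (y 2) * S₀ (y 1) (y 3)
      + S₀ (y 0) (y 3) * S₀ (y 1) (y 2)) = -(2 * pmin S₀ y * θ y) := by
  simp only [Fθ, wick, P₁, P₂, P₃]; ring

/-- Every admissible `θ` gives a family with the full soft package (bubble divergence apart, see
`softPackage_Fθ`). [folklore] -/
theorem softPackage_Fθ_core {θ : (Fin 4 → Site 3) → ℝ} (hθ : ThetaHyp θ)
    (hbubble : ¬ Summable (fun x : Site 3 => S₀ 0 x ^ 2)) : SoftPackage S₀ T₀ (Fθ θ) where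
  two x := rfl
  symm := S₀_symm
  transl := S₀_transl
  perm := S₀_perm
  refl := S₀_refl
  diag := S₀_diag
  pos := S₀_pos
  le_one := S₀_le_one
  upper := ⟨1, S₀_upper⟩
  lower := ⟨1 / 2, by norm_num, S₀_lower⟩
  mms := S₀_mms
  gks_pair := S₀_gks_pair
  bubble := hbubble
  swap01 y := by
    simp only [Fθ, wick_swap01 S₀_symm, pmin_swap01 S₀_symm, hθ.swap01]
  swap12 y := by
    simp only [Fθ, wick_swap12 S₀_symm, pmin_swap12 S₀_symm, hθ.swap12]
  swap23 y := by
    simp only [Fθ, wick_swap23 S₀_symm, pmin_swap23 S₀_symm, hθ.swap23]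
  translF y v := by
    simp only [Fθ, wick_transl, pmin_transl, hθ.transl]
  coincide a x z := by
    have hP : pmin S₀ ![a, a, x, z] = S₀ a x * S₀ a z := by
      unfold pmin P₁ P₂ P₃
      simp only [Matrix.cons_val_zero, Matrix.cons_val_one, Matrix.cons_val]
      have h1 : S₀ a x * S₀ a z ≤ S₀ a a * S₀ x z := by
        rw [S₀_diag, one_mul, S₀_symm a x]; exact S₀_gks_pair x a z
      rw [min_eq_right h1, mul_comm (S₀ a z) (S₀ a x), min_self]
    simp only [Fθ, wick, P₁, P₂, P₃, hP, hθ.coincide, Matrix.cons_val_zero, Matrix.cons_val_one,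
      Matrix.cons_val, S₀_diag]
    ring
  nonneg y := by
    have h := hθ.le_one y
    have h0 := hθ.nonneg y
    have hm := pmin_nonneg y
    have h2 := pmin_le_P₂ y
    have h3 := pmin_le_P₃ y
    have hP1 : 0 ≤ P₁ S₀ y := mul_nonneg (S₀_nonneg _ _) (S₀_nonneg _ _)
    simp only [Fθ, wick]
    nlinarith
  griffiths y := by
    have h := hθ.le_one y
    have h0 := hθ.nonneg y
    have hm := pmin_nonneg y
    have h2 := pmin_le_P₂ y
    have h3 := pmin_le_P₃ y
    show P₁ S₀ y ≤ Fθ θ y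
    simp only [Fθ, wick]
    nlinarith
  lebowitz y := by
    rw [Fθ_sub_wick]
    have := mul_nonneg (mul_nonneg zero_le_two (pmin_nonneg y)) (hθ.nonneg y)
    linarith
  aizenman y := by
    rw [Fθ_sub_wick]
    have h := hθ.le_one y
    have h0 := hθ.nonneg y
    have hm := pmin_nonneg y
    have h1 := pmin_le_P₁ y
    show -(2 * P₁ S₀ y) ≤ -(2 * pmin S₀ y * θ y)
    nlinarith

end Summit.CriticalPhenomena.Ising3DConformalLimit.Theorems.GapForcesFarMerging.Negative

end
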